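import Summits.HodgeConjecture.CorCM.Census.OddSliceTranslation
import Mathlib.Logic.Function.Basic

/-!
# Odd slices, II: the explicit generators `v_b`, their Hodge property, and the clearing step

COR-CM (cell `pub-hodgecm2`), count-neutral kernel census by the binder seat b09 (gen 24; lane DEG22-MU, answering lit-andre-3's
ask A6-R35 «`ℤ/22`: is `μ = 93`?»), in the generic odd-slice model of `Census/OddDegreeParityLaw.lean` (b17 gen 48) — no `decide`
table, no certificate, no named fact, no geometry, no `sorry`.  HC_CM is not proved anywhere in this cell; nothing here is a
headline and nothing here produces a period.

Part II of three.  HYPOTHESES carried as explicit arguments (all met by the faithful full slice of every Galois CM type `(G, c)` with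
`|G| ≡ 2 (mod 4)`, cf. the dictionary of the parity-law file): a block `e` with `A_e = 0` (the CM elliptic curve `E`); a block `b₁`
with `π_{b₁}` bijective — an inverse `σ : A_{b₁} → A` is part of the data — and `φ_{b₁} = 𝟙_{y = 0}` (the FULL SINGLE-DEFECT block
`B₁`: the type `{(1,0)} ∪ {(0,y) : y ≠ 0}` has no period; translating the representative puts the defect at `0`); all `π_b` surjective
(`A_b = A / Per(φ_b)`).
THE GENERATORS (`sgnE`, `defects`, `gen`, `genFamily`).  For a block `b` let `D_b := {z ∈ A_{b₁} : φ_b(π_b(σ(−z))) = 1}` (its defect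
set pulled back to `A ≅ A_{b₁}`), `K_b := |D_b|`, `ε := +1` if `φ_e(0) = 0` else `−1`, and
  `v_b := e_{(b,0,0)} − Σ_{z ∈ D_b} e_{(b₁,0,z)} + ε (K_b − 1) · e_{(e,0,0)}`
— modulo divisor classes the exponent vector of a Hodge class of degree `2K_b` on `B_b × B₁ × E^{K_b−1}` (dictionary, not
formalised).  `genFamily = {v_b : b ∉ {e, b₁}} ∪ {weilVec φ e b₁}` has at most `|ι| − 1` members (`genFamily_card_le`).
CONTENT: `v_b ∈ H` (`gen_mem`: the form of `(0,t)` on `v_b` is `s − (K_b − 2·[φ_b(π_b t) = 1]) + (K_b − 1) = 0`, `s = ±1` the sign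
of the label `(b,0,0)`); the translate `(0,t)·v_b` in closed form (`transl_gen`) and its values (`transl_gen_apply_of_ne/odd/self`);
the CLEARING combination `clear u = red u − Σ_{b ∉ {e,b₁}} Σ_z red(u)_{(b,0,z)} · ((0,t_{b,z})·v_b)` with `π_b t_{b,z} = z`: it is
Hodge when `u` is (`clear_mem`), differs from `red u` by an element of the span of the translates of `genFamily`
(`red_sub_clear_mem_span`), and is SUPPORTED on the even labels of `b₁` and the label `(e,0,0)` (`clear_support`).  Part III turns
this into `H ≤ P + ℤ[G]·genFamily`.  All [folklore].

## References
* [Pohlmann1968] H. Pohlmann, Algebraic cycles on abelian varieties of complex multiplication type, Ann. of Math. 88 (1968), Thm 1.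
* [Milne1999] J. S. Milne, Lefschetz motives and the Tate conjecture, Compositio Math. 117 (1999), Prop. 2.1, p. 54.
* [Weil1977HodgeRing] A. Weil, Abelian varieties and the Hodge ring, Œuvres Scientifiques III, [1977c], 421–429.
-/

namespace Summit.HodgeConjecture.CorCM.Census.OddSliceGenerators

open Finset
open Summit.HodgeConjecture.CorCM.Census.OddDegreeParityLaw
open Summit.HodgeConjecture.CorCM.Census.OddSliceTranslation

variable {A : Type*} [AddCommGroup A]
variable {ι : Type*} [Fintype ι] [DecidableEq ι]
variable {Ab : ι → Type*} [∀ b, AddCommGroup (Ab b)] [∀ b, Fintype (Ab b)] [∀ b, DecidableEq (Ab b)]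

/-! ## §1 The generators -/

/-- The sign `ε = ±1` of the curve block: `+1` iff `φ_e(0) = 0`. [folklore] -/
def sgnE (φ : ∀ b, Ab b → ZMod 2) (e : ι) : ℤ := if (0 : ZMod 2) = φ e 0 then 1 else -1

/-- The defect set of block `b` transported to `A_{b₁}` along `σ = π_{b₁}⁻¹`: `D_b = {z : φ_b(π_b(σ(−z))) = 1}`. [folklore] -/
def defects (π : ∀ b, A →+ Ab b) (φ : ∀ b, Ab b → ZMod 2) (b₁ : ι) (σ : Ab b₁ → A) (b : ι) : Finset (Ab b₁) :=
  univ.filter fun z => φ b (π b (σ (-z))) = 1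

/-- **The generator of block `b`**: `v_b = e_{(b,0,0)} − Σ_{z ∈ D_b} e_{(b₁,0,z)} + ε(|D_b| − 1)·e_{(e,0,0)}` — modulo divisor classes
the exponent vector of a Hodge class of degree `2|D_b|` on `B_b × B₁ × E^{|D_b|−1}`. [folklore] -/
def gen (π : ∀ b, A →+ Ab b) (φ : ∀ b, Ab b → ZMod 2) (e b₁ : ι) (σ : Ab b₁ → A) (b : ι) : Pt Ab → ℤ :=
  Pi.single (⟨b, (0, 0)⟩ : Pt Ab) 1 - ∑ z ∈ defects π φ b₁ σ b, Pi.single (⟨b₁, (0, z)⟩ : Pt Ab) 1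
    + (sgnE φ e * (((defects π φ b₁ σ b).card : ℤ) - 1)) • Pi.single (⟨e, (0, 0)⟩ : Pt Ab) 1

/-- **The generating family**: one generator per block other than `e`, `b₁`, and the Weil vector of `E^{|A|−2} × B₁`. [folklore] -/
def genFamily (π : ∀ b, A →+ Ab b) (φ : ∀ b, Ab b → ZMod 2) (e b₁ : ι) (σ : Ab b₁ → A) : Finset (Pt Ab → ℤ) :=
  ((univ.erase e).erase b₁).image (gen π φ e b₁ σ) ∪ {weilVec φ e b₁}

/-- The generating family has at most `|ι| − 1` members. [folklore] -/
theorem genFamily_card_le (π : ∀ b, A →+ Ab b) (φ : ∀ b, Ab b → ZMod 2) (e b₁ : ι) (σ : Ab b₁ → A) (hne : b₁ ≠ e) :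
    (genFamily π φ e b₁ σ).card + 1 ≤ Fintype.card ι := by
  unfold genFamily
  have h1 : b₁ ∈ univ.erase e := Finset.mem_erase.mpr ⟨hne, Finset.mem_univ _⟩
  have hc : ((univ.erase e).erase b₁).card + 2 = Fintype.card ι := by
    rw [Finset.card_erase_of_mem h1, Finset.card_erase_of_mem (Finset.mem_univ _), Finset.card_univ]
    have : 2 ≤ Fintype.card ι := by
      have hsub : ({b₁, e} : Finset ι) ⊆ univ := Finset.subset_univ _
      have := Finset.card_le_card hsub
      rwa [Finset.card_pair hne, Finset.card_univ] at this
    omega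
  calc (((univ.erase e).erase b₁).image (gen π φ e b₁ σ) ∪ {weilVec φ e b₁}).card + 1
      ≤ ((((univ.erase e).erase b₁).image (gen π φ e b₁ σ)).card + ({weilVec φ e b₁} : Finset _).card) + 1 :=
        Nat.add_le_add_right (Finset.card_union_le _ _) 1
    _ ≤ (((univ.erase e).erase b₁).card + 1) + 1 :=
        Nat.add_le_add_right (Nat.add_le_add Finset.card_image_le (by simp)) 1
    _ = Fintype.card ι := by omega

section Main

variable (π : ∀ b, A →+ Ab b) (φ : ∀ b, Ab b → ZMod 2) (e b₁ : ι) (σ : Ab b₁ → A)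

omit [Fintype ι] [DecidableEq ι] [∀ b, Fintype (Ab b)] [∀ b, DecidableEq (Ab b)] in
/-- `φ_{b₁}` takes the value `0` exactly off the origin. [folklore] -/
theorem phi_one_eq_zero_iff (include_hφ₁ : ∀ z : Ab b₁, φ b₁ z = 1 ↔ z = 0) (z : Ab b₁) :
    (0 : ZMod 2) = φ b₁ z ↔ z ≠ 0 := by
  have h01 : ∀ a : ZMod 2, a = 0 ∨ a = 1 := by decide
  constructor
  · intro h hz
    have := (include_hφ₁ z).mpr hz
    rw [← h] at this
    exact absurd this (by decide)
  · intro hz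
    rcases h01 (φ b₁ z) with h | h
    · exact h.symm
    · exact absurd ((include_hφ₁ z).mp h) hz

/-- The form of `(0,t)` on the `b₁`-part `Σ_{z ∈ D} c_z e_{(b₁,0,z)}`: `Σ_{z ∈ D} c_z − 2·c_{−π₁ t}·[−π₁ t ∈ D]`. [folklore] -/
theorem hodgeVec_zero_dotProduct_sum_b1 (include_hφ₁ : ∀ z : Ab b₁, φ b₁ z = 1 ↔ z = 0) (t : A) (D : Finset (Ab b₁))
    (c : Ab b₁ → ℤ) :
    hodgeVec π φ (0, t) ⬝ᵥ (∑ z ∈ D, c z • Pi.single (⟨b₁, (0, z)⟩ : Pt Ab) (1 : ℤ)) =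
      (∑ z ∈ D, c z) - 2 * (if -π b₁ t ∈ D then c (-π b₁ t) else 0) := by
  rw [dotProduct_sum]
  have hterm : ∀ z ∈ D, hodgeVec π φ (0, t) ⬝ᵥ (c z • Pi.single (⟨b₁, (0, z)⟩ : Pt Ab) (1 : ℤ)) =
      c z - 2 * (if -π b₁ t = z then c z else 0) := by
    intro z _
    rw [dotProduct_smul, hodgeVec_zero_dotProduct_single, mul_one, smul_eq_mul]
    by_cases hz : -π b₁ t = z
    · have hcond : ¬ ((0 : ZMod 2) = φ b₁ (z + π b₁ t)) := by
        rw [phi_one_eq_zero_iff φ b₁ include_hφ₁, not_not, ← hz, neg_add_cancel]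
      rw [if_neg hcond, if_pos hz]; ring
    · have hcond : (0 : ZMod 2) = φ b₁ (z + π b₁ t) := by
        rw [phi_one_eq_zero_iff φ b₁ include_hφ₁]
        intro h
        exact hz (eq_neg_of_add_eq_zero_left h).symm
      rw [if_pos hcond, if_neg hz]; ring
  rw [Finset.sum_congr rfl hterm, Finset.sum_sub_distrib, ← Finset.mul_sum, Finset.sum_ite_eq]

/-- The form of `(0,t)` on `Σ_{z ∈ D} e_{(b₁,0,z)}`: `|D| − 2·[−π₁ t ∈ D]`. [folklore] -/
theorem hodgeVec_zero_dotProduct_sum_b1_one (include_hφ₁ : ∀ z : Ab b₁, φ b₁ z = 1 ↔ z = 0) (t : A)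
    (D : Finset (Ab b₁)) :
    hodgeVec π φ (0, t) ⬝ᵥ (∑ z ∈ D, Pi.single (⟨b₁, (0, z)⟩ : Pt Ab) (1 : ℤ)) =
      (D.card : ℤ) - 2 * (if -π b₁ t ∈ D then 1 else 0) := by
  have h := hodgeVec_zero_dotProduct_sum_b1 π φ b₁ include_hφ₁ t D (fun _ => (1 : ℤ))
  simp only [one_smul, Finset.sum_const, nsmul_eq_mul, mul_one] at h
  exact h

/-- The form of `(0,t)` on the `E`-label `(e,0,0)` is `ε`. [folklore] -/
theorem hodgeVec_zero_dotProduct_single_e0 (include_he : ∀ y : Ab e, y = 0) (t : A) (c : ℤ) :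
    hodgeVec π φ (0, t) ⬝ᵥ (c • Pi.single (⟨e, (0, 0)⟩ : Pt Ab) (1 : ℤ)) = c * sgnE φ e := by
  rw [dotProduct_smul, hodgeVec_zero_dotProduct_single, include_he (0 + π e t), mul_one, smul_eq_mul, sgnE]

omit [Fintype ι] [DecidableEq ι] [∀ b, Fintype (Ab b)] [∀ b, DecidableEq (Ab b)] in
/-- `ε² = 1`. [folklore] -/
theorem sgnE_mul_self : sgnE φ e * sgnE φ e = 1 := by
  unfold sgnE; split_ifs <;> norm_num

/-- **The generators are Hodge vectors.** [folklore] -/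
theorem gen_mem (include_he : ∀ y : Ab e, y = 0) (include_hσ' : ∀ y : A, σ (π b₁ y) = y)
    (include_hφ₁ : ∀ z : Ab b₁, φ b₁ z = 1 ↔ z = 0) (b : ι) :
    gen π φ e b₁ σ b ∈ hodgeLattice π φ := by
  rw [mem_hodgeLattice_iff]
  intro t
  have h01 : ∀ a : ZMod 2, a = 0 ∨ a = 1 := by decide
  set D := defects π φ b₁ σ b with hD
  unfold gen
  rw [dotProduct_add, dotProduct_sub, hodgeVec_zero_dotProduct_sum_b1_one π φ b₁ include_hφ₁,
    hodgeVec_zero_dotProduct_single_e0 π φ e include_he, hodgeVec_zero_dotProduct_single, mul_one]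
  have hmem : (-π b₁ t ∈ D) ↔ φ b (π b t) = 1 := by
    rw [hD, defects, Finset.mem_filter, neg_neg, include_hσ']
    simp
  have hmul : sgnE φ e * ((D.card : ℤ) - 1) * sgnE φ e = (D.card : ℤ) - 1 := by
    have hs := sgnE_mul_self φ e
    have : sgnE φ e * ((D.card : ℤ) - 1) * sgnE φ e = (sgnE φ e * sgnE φ e) * ((D.card : ℤ) - 1) := by ring
    rw [this, hs, one_mul]
  rw [hmul]
  rcases h01 (φ b (0 + π b t)) with h0 | h1
  · have h0' : φ b (π b t) = 0 := by simpa using h0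
    have hnot : ¬ (-π b₁ t ∈ D) := by rw [hmem, h0']; decide
    rw [if_pos h0.symm, if_neg hnot]
    ring
  · have h1' : φ b (π b t) = 1 := by simpa using h1
    have hne1 : ¬ ((0 : ZMod 2) = φ b (0 + π b t)) := by rw [h1]; decide
    rw [if_neg hne1, if_pos (hmem.mpr h1')]
    ring

/-! ## §2 Translated generators and the clearing step -/

omit [Fintype ι] in
/-- Translate of a generator by `(0,t)`: unit vectors at even labels of `b`, `b₁`, `e` only. [folklore] -/
theorem transl_gen (include_he : ∀ y : Ab e, y = 0) (t : A) (b : ι) :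
    transl π (0, t) (gen π φ e b₁ σ b) =
      Pi.single (⟨b, (0, π b t)⟩ : Pt Ab) 1 - ∑ z ∈ defects π φ b₁ σ b, Pi.single (⟨b₁, (0, z + π b₁ t)⟩ : Pt Ab) 1
        + (sgnE φ e * (((defects π φ b₁ σ b).card : ℤ) - 1)) • Pi.single (⟨e, (0, 0)⟩ : Pt Ab) 1 := by
  rw [← translHom_apply, gen, map_add, map_sub, map_smul, map_sum]
  simp only [translHom_apply, transl_single, act, add_zero, zero_add, include_he (0 + π e t)]

omit [Fintype ι] in
/-- A translated generator of block `b` vanishes on every block other than `b`, `b₁`, `e`. [folklore] -/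
theorem transl_gen_apply_of_ne (include_he : ∀ y : Ab e, y = 0) (t : A) (b : ι) {b' : ι} (hb : b' ≠ b)
    (hb1 : b' ≠ b₁) (hbe : b' ≠ e) (p : ZMod 2 × Ab b') :
    transl π (0, t) (gen π φ e b₁ σ b) ⟨b', p⟩ = 0 := by
  rw [transl_gen π φ e b₁ σ include_he, Pi.add_apply, Pi.sub_apply, Finset.sum_apply, Pi.smul_apply,
    single_apply_of_ne hb, Finset.sum_eq_zero fun z _ => single_apply_of_ne hb1 _ _ _, single_apply_of_ne hbe]
  simp

omit [Fintype ι] in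
/-- A translated generator vanishes on the odd labels. [folklore] -/
theorem transl_gen_apply_odd (include_he : ∀ y : Ab e, y = 0) (t : A) (b b' : ι) (y : Ab b') :
    transl π (0, t) (gen π φ e b₁ σ b) ⟨b', (1, y)⟩ = 0 := by
  have h10 : ∀ (b'' : ι) (z : Ab b''), (Pi.single (⟨b'', (0, z)⟩ : Pt Ab) (1 : ℤ) : Pt Ab → ℤ) ⟨b', (1, y)⟩ = 0 := by
    intro b'' z
    by_cases h : b' = b''
    · subst h
      rw [single_apply_same, if_neg (pair_one_ne_pair_zero y z)]
    · exact single_apply_of_ne h _ _ _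
  rw [transl_gen π φ e b₁ σ include_he, Pi.add_apply, Pi.sub_apply, Finset.sum_apply, Pi.smul_apply,
    h10, Finset.sum_eq_zero fun z _ => h10 _ _, h10]
  simp

omit [Fintype ι] in
/-- A translated generator of block `b ∉ {b₁, e}` on the labels of block `b`. [folklore] -/
theorem transl_gen_apply_self (include_he : ∀ y : Ab e, y = 0) (t : A) {b : ι} (hb1 : b ≠ b₁) (hbe : b ≠ e)
    (p : ZMod 2 × Ab b) :
    transl π (0, t) (gen π φ e b₁ σ b) ⟨b, p⟩ = if p = (0, π b t) then 1 else 0 := by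
  rw [transl_gen π φ e b₁ σ include_he, Pi.add_apply, Pi.sub_apply, Finset.sum_apply, Pi.smul_apply,
    single_apply_same, Finset.sum_eq_zero fun z _ => single_apply_of_ne hb1 _ _ _, single_apply_of_ne hbe]
  simp

/-- The clearing combination: `red u` minus the translates of the generators that kill its blocks `b ∉ {e, b₁}`. [folklore] -/
noncomputable def clear (hπ : ∀ b, Function.Surjective (π b)) (u : Pt Ab → ℤ) : Pt Ab → ℤ :=
  red u - ∑ b ∈ (univ.erase e).erase b₁, ∑ z : Ab b,
    red u ⟨b, (0, z)⟩ • transl π (0, Function.surjInv (hπ b) z) (gen π φ e b₁ σ b)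

/-- The subtracted combination lies in the span of the translates of the generating family. [folklore] -/
theorem red_sub_clear_mem_span (hπ : ∀ b, Function.Surjective (π b)) (u : Pt Ab → ℤ) :
    red u - clear π φ e b₁ σ hπ u ∈
      Submodule.span ℤ {v | ∃ g : ZMod 2 × A, ∃ t ∈ genFamily π φ e b₁ σ, v = transl π g t} := by
  unfold clear
  rw [sub_sub_cancel]
  refine Submodule.sum_mem _ fun b hb => Submodule.sum_mem _ fun z _ => Submodule.smul_mem _ _ (Submodule.subset_span ?_)
  refine ⟨(0, Function.surjInv (hπ b) z), gen π φ e b₁ σ b, ?_, rfl⟩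
  unfold genFamily
  exact Finset.mem_union_left _ (Finset.mem_image_of_mem _ hb)

/-- `clear u` is Hodge when `u` is. [folklore] -/
theorem clear_mem (include_he : ∀ y : Ab e, y = 0) (include_hσ' : ∀ y : A, σ (π b₁ y) = y)
    (include_hφ₁ : ∀ z : Ab b₁, φ b₁ z = 1 ↔ z = 0) (hπ : ∀ b, Function.Surjective (π b)) {u : Pt Ab → ℤ}
    (hu : u ∈ hodgeLattice π φ) : clear π φ e b₁ σ hπ u ∈ hodgeLattice π φ := by
  unfold clear
  exact Submodule.sub_mem _ (red_mem π φ hu) (Submodule.sum_mem _ fun b _ => Submodule.sum_mem _ fun z _ =>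
    Submodule.smul_mem _ _ (transl_mem π φ (gen_mem π φ e b₁ σ include_he include_hσ' include_hφ₁ b) _))

/-- **Support of the cleared vector**: only even labels of `b₁` and the label `(e,0,0)` survive. [folklore] -/
theorem clear_support (include_he : ∀ y : Ab e, y = 0) (include_hne : b₁ ≠ e) (hπ : ∀ b, Function.Surjective (π b))
    (u : Pt Ab → ℤ) (x : Pt Ab) (hx : clear π φ e b₁ σ hπ u x ≠ 0) :
    (x.1 = b₁ ∧ x.2.1 = 0) ∨ x = ⟨e, (0, 0)⟩ := by
  obtain ⟨b', a, y⟩ := x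
  have h01 : ∀ a : ZMod 2, a = 0 ∨ a = 1 := by decide
  by_contra hcon
  apply hx
  unfold clear
  rw [Pi.sub_apply, Finset.sum_apply]
  simp only [Finset.sum_apply, Pi.smul_apply, smul_eq_mul]
  -- odd labels: everything vanishes
  rcases h01 a with ha | ha
  · -- even label: then the block is neither `b₁` nor `e`
    subst ha
    have hb1 : b' ≠ b₁ := fun h => hcon (Or.inl ⟨h, rfl⟩)
    have hbe : b' ≠ e := by
      intro h; subst h
      exact hcon (Or.inr (by rw [include_he y]))
    have hmem : b' ∈ (univ.erase e).erase b₁ :=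
      Finset.mem_erase.mpr ⟨hb1, Finset.mem_erase.mpr ⟨hbe, Finset.mem_univ _⟩⟩
    rw [Finset.sum_eq_single b' ?_ (fun h => absurd hmem h)]
    · rw [Finset.sum_congr rfl fun z _ => by
        rw [transl_gen_apply_self π φ e b₁ σ include_he _ hb1 hbe, Function.surjInv_eq (hπ b') z]]
      have : ∀ z : Ab b', red u ⟨b', (0, z)⟩ * (if ((0 : ZMod 2), y) = (0, z) then (1 : ℤ) else 0) =
          if y = z then red u ⟨b', (0, z)⟩ else 0 := by
        intro z
        by_cases h : y = z
        · subst h; simp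
        · rw [if_neg h, if_neg (fun hh => h ((pair_zero_eq_iff y z).mp hh)), mul_zero]
      rw [Finset.sum_congr rfl fun z _ => this z, Finset.sum_ite_eq, if_pos (Finset.mem_univ _), sub_self]
    · intro b hb hbb
      exact Finset.sum_eq_zero fun z _ => by
        rw [transl_gen_apply_of_ne π φ e b₁ σ include_he _ _ (Ne.symm hbb) hb1 hbe, mul_zero]
  · subst ha
    rw [red_apply, if_neg (by decide)]
    rw [Finset.sum_eq_zero fun b _ => Finset.sum_eq_zero fun z _ => by
      rw [transl_gen_apply_odd π φ e b₁ σ include_he, mul_zero]]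
    simp

end Main

end Summit.HodgeConjecture.CorCM.Census.OddSliceGenerators
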